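import Summits.ResolutionOfSingularities.ResolutionOfSingularities.Theorems.FrobeniusLadderFRationalResolutionChartAlgebraFixedPoint
import HarnessLib

/-!
# Crux `FrobeniusLadder.FRationalResolution` (stmt-ResolutionOfSingularities-15317), line `redirect`,
# stub `stub_diagonalizableQuotientResolution` — **the torus-fixed STRATUM of a chart algebra is a closed
# subscheme of the base stratum: `A_𝔭 → C_𝔓 ⧸ I(𝔓, χ)C_𝔓` is surjective** (brick of design C3 = the rank-2
# stratum layer of the non-isolated case, memo MEMO-15317-leafhand2-g10 §2 (L2): the dimension count and the
# identification of the new singular locus along a POSITIVE-dimensional stratum both go through this map)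

Setting as in `…ChartAlgebraNormalForm` / `…ChartAlgebraFixedPoint`: a chart `φ : P → A`, a prime `𝔭` with unit
face `F_𝔭`, a chart algebra `C = A[χ(Q)]` (`χ : Q → C` extending `φ` along `P ≤ Q ⊆ ℤⁿ`), and a prime `𝔓` of `C`
over `𝔭` containing `χ(Q ∖ ℤF_𝔭)` — a point of the torus-fixed stratum (e.g. of a blow-up chart `A[I/φ(a)]`).
* `span_le_ideal_of_fixedPrime` — the `A`-span of `χ(Q ∖ ℤF_𝔭)` lies in Kato's ideal `I(𝔓, χ)`;
* `not_mem_of_val_mul_eq_add` — in a normal form `φ(g)·s = b + y'` (`…ChartAlgebraNormalForm.exists_val_mul_eq_add`)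
  of an element `s ∉ 𝔓`, the constant `b` is a unit at `𝔭`;
* **`surjective_quotientMk_comp_localRingHom_of_fixedPrime`** — every element of `C_𝔓 ⧸ I(𝔓, χ)C_𝔓` is the image
  of an element of `A_𝔭`: for `c/s ∈ C_𝔓` with normal forms `φ(f)c = a + y`, `φ(g)s = b + y'` the preimage is
  `a φ(g) / (φ(f) b)` (pure algebra, no log regularity, no dimension hypothesis). In the surface recursion of
  lineage 2 the stratum of `𝔭` is a point and this quotient is the residue field `κ(𝔭)`
  (`…ChartAlgebraFixedPoint`, residue statement); along a stratum of positive dimension it says that the fixed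
  stratum `V(I(𝔓, χ))` of the new chart embeds into the base stratum `V(I(𝔭, φ))` near `𝔭`.

Honest label: generic local algebra toward ONE leaf stub (no stub, crux or summit closed). No definitions, no named
facts, no sorry. [cite: Kato1994, Def. (2.1), (10.1)] [cite: Niziol2006, §4]
-/

noncomputable section

-- single-problem summit: the doubled namespace component is forced
set_option linter.dupNamespace false

open IsLocalRing Literature.AlgebraicGeometry.Resolution Literature.AlgebraicGeometry.Resolution.LogChart
open Summit.ResolutionOfSingularities.ResolutionOfSingularities.Theorems.FRationalResolution.ChartAlgebraNormalForm

namespace Summit.ResolutionOfSingularities.ResolutionOfSingularities.Theorems.FRationalResolution.FixedStratumResidue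

universe u

variable {A : Type u} [CommRing A] {n : ℕ} {P : AddSubmonoid (Fin n → ℤ)} {φ : Multiplicative P →* A}
  {𝔭 : Ideal A} [𝔭.IsPrime] {C : Type u} [CommRing C] [Algebra A C] {Q : AddSubmonoid (Fin n → ℤ)}
  {χ : Multiplicative Q →* C} {𝔓 : Ideal C} [𝔓.IsPrime]

omit [𝔓.IsPrime] in
/-- At a prime `𝔓` containing `χ(Q ∖ ℤF_𝔭)`, the `A`-span of these chart elements lies in Kato's ideal `I(𝔓, χ)`.
[cite: Kato1994, Def. (2.1)] -/
theorem span_le_ideal_of_fixedPrime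
    (hq : ∀ q : Q, (q : Fin n → ℤ) ∉ Submodule.span ℤ (faceMonoid P φ 𝔭 : Set (Fin n → ℤ)) →
      χ (Multiplicative.ofAdd q) ∈ 𝔓)
    {y : C} (hy : y ∈ Submodule.span A ((fun q : Q => χ (Multiplicative.ofAdd q)) ''
      {q : Q | (q : Fin n → ℤ) ∉ Submodule.span ℤ (faceMonoid P φ 𝔭 : Set (Fin n → ℤ))})) :
    y ∈ ideal Q χ 𝔓 := by
  have h : Submodule.span A ((fun q : Q => χ (Multiplicative.ofAdd q)) ''
      {q : Q | (q : Fin n → ℤ) ∉ Submodule.span ℤ (faceMonoid P φ 𝔭 : Set (Fin n → ℤ))}) ≤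
      (ideal Q χ 𝔓).restrictScalars A := by
    rw [Submodule.span_le]
    rintro _ ⟨q, hqL, rfl⟩
    exact Ideal.subset_span ⟨q, hq q hqL, rfl⟩
  exact h hy

/-- In a normal form `φ(g)·s = b + y'` with `g ∈ F_𝔭`, `y'` in the `A`-span of `χ(Q ∖ ℤF_𝔭)` and `s ∉ 𝔓` (where
`𝔓 ∩ A = 𝔭` and `𝔓 ⊇ χ(Q ∖ ℤF_𝔭)`), the constant `b` does not lie in `𝔭`. [folklore] -/
theorem not_mem_of_val_mul_eq_add (h𝔓 : 𝔓.comap (algebraMap A C) = 𝔭)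
    (hq : ∀ q : Q, (q : Fin n → ℤ) ∉ Submodule.span ℤ (faceMonoid P φ 𝔭 : Set (Fin n → ℤ)) →
      χ (Multiplicative.ofAdd q) ∈ 𝔓)
    {g : Fin n → ℤ} (hg : g ∈ faceMonoid P φ 𝔭) {s : C} (hs : s ∉ 𝔓) {b : A} {y' : C}
    (hy' : y' ∈ Submodule.span A ((fun q : Q => χ (Multiplicative.ofAdd q)) ''
      {q : Q | (q : Fin n → ℤ) ∉ Submodule.span ℤ (faceMonoid P φ 𝔭 : Set (Fin n → ℤ))}))
    (he : algebraMap A C (val P φ g) * s = algebraMap A C b + y') : b ∉ 𝔭 := by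
  intro hb
  have hb' : algebraMap A C b ∈ 𝔓 := by
    have : b ∈ 𝔓.comap (algebraMap A C) := by rw [h𝔓]; exact hb
    exact this
  have hy'𝔓 : y' ∈ 𝔓 := ideal_le Q χ 𝔓 (span_le_ideal_of_fixedPrime hq hy')
  have hprod : algebraMap A C (val P φ g) * s ∈ 𝔓 := by rw [he]; exact 𝔓.add_mem hb' hy'𝔓
  rcases (Ideal.IsPrime.mem_or_mem inferInstance hprod) with h | h
  · have : val P φ g ∈ 𝔓.comap (algebraMap A C) := h
    rw [h𝔓] at this
    exact ((mem_faceMonoid P φ 𝔭).1 hg).2 this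
  · exact hs h

/-- **The fixed stratum embeds into the base stratum: `A_𝔭 → C_𝔓 ⧸ I(𝔓, χ)C_𝔓` is onto.** For the chart algebra
`C = A[χ(Q)]` (`χ` extending `φ`, `C` generated by `χ(Q)`) and a prime `𝔓` over `𝔭` containing `χ(Q ∖ ℤF_𝔭)`,
the local homomorphism `A_𝔭 → C_𝔓` followed by reduction modulo Kato's ideal `I(𝔓, χ)C_𝔓` is surjective.
[cite: Kato1994, Def. (2.1), (10.1)] [cite: Niziol2006, §4] -/
theorem surjective_quotientMk_comp_localRingHom_of_fixedPrime (hPQ : P ≤ Q)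
    (hχ : ∀ p : P, χ (Multiplicative.ofAdd ⟨(p : Fin n → ℤ), hPQ p.2⟩) =
      algebraMap A C (φ (Multiplicative.ofAdd p)))
    (hgen : Algebra.adjoin A (Set.range χ) = ⊤)
    (h𝔓 : 𝔓.comap (algebraMap A C) = 𝔭)
    (hq : ∀ q : Q, (q : Fin n → ℤ) ∉ Submodule.span ℤ (faceMonoid P φ 𝔭 : Set (Fin n → ℤ)) →
      χ (Multiplicative.ofAdd q) ∈ 𝔓) :
    Function.Surjective ((Ideal.Quotient.mk ((ideal Q χ 𝔓).map (algebraMap C (Localization.AtPrime 𝔓)))).comp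
      (Localization.localRingHom 𝔭 𝔓 (algebraMap A C) h𝔓.symm)) := by
  intro z
  obtain ⟨w, rfl⟩ := Ideal.Quotient.mk_surjective z
  obtain ⟨⟨c, s⟩, rfl⟩ := IsLocalization.mk'_surjective 𝔓.primeCompl w
  -- normal forms of numerator and denominator
  obtain ⟨f, hf, a, y, hy, hc⟩ := exists_val_mul_eq_add (𝔭 := 𝔭) hPQ hχ hgen c
  obtain ⟨g, hg, b, y', hy', hs⟩ := exists_val_mul_eq_add (𝔭 := 𝔭) hPQ hχ hgen (s : C)
  have hyI : y ∈ ideal Q χ 𝔓 := span_le_ideal_of_fixedPrime hq hy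
  have hy'I : y' ∈ ideal Q χ 𝔓 := span_le_ideal_of_fixedPrime hq hy'
  have hb : b ∉ 𝔭 := not_mem_of_val_mul_eq_add h𝔓 hq hg s.2 hy' hs
  have hfu : val P φ f ∉ 𝔭 := ((mem_faceMonoid P φ 𝔭).1 hf).2
  have hden : val P φ f * b ∈ 𝔭.primeCompl := fun h =>
    (Ideal.IsPrime.mem_or_mem inferInstance h).elim hfu hb
  refine ⟨IsLocalization.mk' (Localization.AtPrime 𝔭) (a * val P φ g) ⟨val P φ f * b, hden⟩, ?_⟩
  rw [RingHom.comp_apply, Localization.localRingHom_mk', Ideal.Quotient.eq, ← IsLocalization.mk'_sub,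
    IsLocalization.mk'_mem_iff]
  have key : algebraMap A C (a * val P φ g) * (s : C) - c * algebraMap A C (val P φ f * b) =
      algebraMap A C a * y' - y * algebraMap A C b := by
    rw [map_mul, map_mul]
    linear_combination (algebraMap A C a) * hs - (algebraMap A C b) * hc
  change algebraMap C (Localization.AtPrime 𝔓)
      (algebraMap A C (a * val P φ g) * (s : C) - c * algebraMap A C (val P φ f * b)) ∈ _
  rw [key]
  exact Ideal.mem_map_of_mem _ (Ideal.sub_mem _ (Ideal.mul_mem_left _ _ hy'I) (Ideal.mul_mem_right _ _ hyI))

end Summit.ResolutionOfSingularities.ResolutionOfSingularities.Theorems.FRationalResolution.FixedStratumResidue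

end
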